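import Mathlib
import Summits.ValiantsHypothesis.ValiantsHypothesis.Theorems.BarrierLeverPartitionMinorsHitByVPHiddenStatesHubJoins
import Summits.ValiantsHypothesis.ValiantsHypothesis.Theorems.BarrierLeverPartitionMinorsHitByVPHiddenStatesStarJoins

/-!
# Route BarrierLever — item `PartitionMinorsHitByVP` (stmt-ValiantsHypothesis-19717), line `hidden-states`,
# stub `stub_qjoinSharp` (Q_join(h²)): the AXIS TABLE — hub joins are good FOR ALL ROW FAMILIES up to `r = 2h³+4h²+6h`

Helper file (`--supports stmt-ValiantsHypothesis-19717`; cell valiant-natproofs, rung V4, 𝒟-side door (c); prover seat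
val-np-p8 gen 3, lane `stub_qjoinSharp`). Bookkeeping defs (`cyPt`, `axisTab`, `ppar`); closes NO item.

THE AXIS TABLE for the hub-join design `hubE` (file `…HiddenStatesHubJoins`): fix a coordinate `y`. The hub state of every
piece carries the axis vector `e_y`; the base of piece `p` is the curve point `c_y(σ) = (s^{2^a})_a` with its `y`-coordinate set
to `0`, and a married satellite `{q}` is another such point `c_y(τ)`. Then a base/satellite column is the vector
`(U ↦ [y ∉ U]·s^{e(U)})` and its translate (hub/pair column, point `c_y(s) + e_y`) is `(U ↦ [y ∉ U] s^{e(U)} + [y ∈ U] s^{e(U∖y)})`: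
the structured columns are the HERMITE functionals `{ev_z, ev_z ∘ ∂_y}` and split into two zeta-free blocks (rows avoiding
`y` / rows containing `y`), each a family of DISTINCT monomials evaluated on the moment curve — independent as soon as the
block has enough rows (`exists_axis_params`, two-block curve filling, `TwoLayer.exists_curveVec_not_mem` twice at once:
`exists_curve_avoid₂`). The unmarried satellites are private and are filled by `JoinFilling.exists_table_of_core`.

THEOREM (`hubJoin_good_of_balanced`). If some coordinate `y` has at least `m(l+1)` members of `u` avoiding it and at least
`m(l+1)` containing it, the hub-join family (`m` pieces, `K` states, `l` married pairs, any `r ≤ m(K+1+l)`) has a table with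
nonsingular block-additive matrix for `u`. BALANCED COORDINATES EXIST (`exists_balanced_coord`): for an injective family of
`r` subsets of `Fin h` and `h(N−1) < 2(r−h−1)` some `y` has `≥ N` members on both sides (the map `U ↦ U ∆ C` is injective, so
at most `h+1` members are within Hamming distance `1` of the set `C` of heavy coordinates).

COROLLARY (`qjoinSharp_of_le_axis`, the stub's body FOR ALL `u`): for every `h ≥ 3` and every `r ≤ 2h(h·h+1) + 4h·h + 4h`
ONE join threshold family (`2h` pieces of `h·h` states; `l = ⌈(r − 2h(h²+1))/(2h)⌉` married pairs per piece, stars below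
the star range via p578997) is good for EVERY injective `u : Fin r → Finset (Fin h)`. In particular (`qjoinSharp_upto_twelve`)
the body of `Stmt.stub_qjoinSharp` holds for every `r ≤ 2^h` when `h ≤ 12`: the first open window of the stub moves from
`h = 12, r ∈ (3480, 4096]` to `h = 13, r ∈ (5200, 8192]`.

WHAT THIS IS NOT: `stub_qjoinSharp` stays open for `h ≥ 13`, `r > 2h³+4h²+6h`; nothing on crux 14610 or VP ≠ VNP.
-/

set_option linter.dupNamespace false

namespace Summit.ValiantsHypothesis.ValiantsHypothesis.Theorems.BarrierLever.HiddenStates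

open Finset Matrix

noncomputable section

namespace HubAxis

open TwoLayer (curveVec binExp_injective)
open JoinFilling (jpt jcol IndepOn det_ne_zero_of_indepOn exists_table_of_core)
open HubJoin (hubStates hubPiece hubE pos_lt hubStates_single hubStates_pair div_mul_add_mod' hubE_injective hub_threshold
  hubW hubWt)

variable {h : ℕ}

/-! ## 1. Two curve families can be made to avoid two proper subspaces at once -/

/-- **Two curves avoid two proper subspaces at once**: for injective set families `u₀, u₁` and proper submodules
`W₀, W₁`, one parameter `s` puts `curveVec u₀ s` outside `W₀` AND `curveVec u₁ s` outside `W₁` (the bad parameters of each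
are the roots of a nonzero polynomial; take a non-root of the product). -/
theorem exists_curve_avoid₂ {n₀ n₁ : Type*} [Fintype n₀] [Fintype n₁] [DecidableEq n₀] [DecidableEq n₁]
    (u₀ : n₀ → Finset (Fin h)) (hu₀ : Function.Injective u₀) (u₁ : n₁ → Finset (Fin h)) (hu₁ : Function.Injective u₁)
    (W₀ : Submodule ℂ (n₀ → ℂ)) (hW₀ : W₀ < ⊤) (W₁ : Submodule ℂ (n₁ → ℂ)) (hW₁ : W₁ < ⊤) :
    ∃ s : ℂ, curveVec u₀ s ∉ W₀ ∧ curveVec u₁ s ∉ W₁ := by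
  classical
  -- functionals vanishing on W_i
  obtain ⟨f₀, hf₀, hf₀W⟩ := Submodule.exists_le_ker_of_lt_top W₀ hW₀
  obtain ⟨f₁, hf₁, hf₁W⟩ := Submodule.exists_le_ker_of_lt_top W₁ hW₁
  -- coefficient vectors and the polynomials
  set c₀ : n₀ → ℂ := fun i => f₀ (Pi.single i 1) with hc₀
  set c₁ : n₁ → ℂ := fun i => f₁ (Pi.single i 1) with hc₁
  have hfc₀ : ∀ v : n₀ → ℂ, f₀ v = ∑ i, c₀ i * v i := by
    intro v
    conv_lhs => rw [show v = ∑ i, v i • (Pi.single i 1 : n₀ → ℂ) from by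
      ext j; simp [Finset.sum_apply, Pi.single_apply]]
    rw [map_sum]; simp only [map_smul, smul_eq_mul, hc₀]
    exact Finset.sum_congr rfl fun i _ => mul_comm _ _
  have hfc₁ : ∀ v : n₁ → ℂ, f₁ v = ∑ i, c₁ i * v i := by
    intro v
    conv_lhs => rw [show v = ∑ i, v i • (Pi.single i 1 : n₁ → ℂ) from by
      ext j; simp [Finset.sum_apply, Pi.single_apply]]
    rw [map_sum]; simp only [map_smul, smul_eq_mul, hc₁]
    exact Finset.sum_congr rfl fun i _ => mul_comm _ _
  have hc₀ne : c₀ ≠ 0 := by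
    intro h0; apply hf₀; apply LinearMap.ext; intro v; rw [hfc₀ v]; simp [h0]
  have hc₁ne : c₁ ≠ 0 := by
    intro h0; apply hf₁; apply LinearMap.ext; intro v; rw [hfc₁ v]; simp [h0]
  set ex₀ : n₀ → ℕ := fun i => ∑ a ∈ u₀ i, 2 ^ (a : ℕ) with hex₀
  set ex₁ : n₁ → ℕ := fun i => ∑ a ∈ u₁ i, 2 ^ (a : ℕ) with hex₁
  have hex₀_inj : Function.Injective ex₀ := fun i j hij => hu₀ (binExp_injective hij)
  have hex₁_inj : Function.Injective ex₁ := fun i j hij => hu₁ (binExp_injective hij)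
  set P₀ : Polynomial ℂ := ∑ i, Polynomial.C (c₀ i) * Polynomial.X ^ ex₀ i with hP₀
  set P₁ : Polynomial ℂ := ∑ i, Polynomial.C (c₁ i) * Polynomial.X ^ ex₁ i with hP₁
  have hP₀eval : ∀ s, P₀.eval s = ∑ i, c₀ i * curveVec u₀ s i := by
    intro s; simp [hP₀, Polynomial.eval_finsetSum, curveVec, hex₀]
  have hP₁eval : ∀ s, P₁.eval s = ∑ i, c₁ i * curveVec u₁ s i := by
    intro s; simp [hP₁, Polynomial.eval_finsetSum, curveVec, hex₁]
  have hP₀ne : P₀ ≠ 0 := by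
    obtain ⟨i₀, hi₀⟩ := Function.ne_iff.mp hc₀ne
    intro hzero
    have hcoeff : P₀.coeff (ex₀ i₀) = c₀ i₀ := by
      rw [hP₀, Polynomial.finsetSum_coeff]
      simp only [Polynomial.coeff_C_mul, Polynomial.coeff_X_pow]
      rw [Finset.sum_eq_single i₀]
      · simp
      · intro j _ hj; rw [if_neg (fun h' => hj (hex₀_inj h'.symm))]; ring
      · intro h'; exact absurd (Finset.mem_univ i₀) h'
    rw [hzero, Polynomial.coeff_zero] at hcoeff
    exact hi₀ hcoeff.symm
  have hP₁ne : P₁ ≠ 0 := by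
    obtain ⟨i₀, hi₀⟩ := Function.ne_iff.mp hc₁ne
    intro hzero
    have hcoeff : P₁.coeff (ex₁ i₀) = c₁ i₀ := by
      rw [hP₁, Polynomial.finsetSum_coeff]
      simp only [Polynomial.coeff_C_mul, Polynomial.coeff_X_pow]
      rw [Finset.sum_eq_single i₀]
      · simp
      · intro j _ hj; rw [if_neg (fun h' => hj (hex₁_inj h'.symm))]; ring
      · intro h'; exact absurd (Finset.mem_univ i₀) h'
    rw [hzero, Polynomial.coeff_zero] at hcoeff
    exact hi₀ hcoeff.symm
  -- a common non-root of P₀ P₁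
  have hPP : P₀ * P₁ ≠ 0 := mul_ne_zero hP₀ne hP₁ne
  have hroot : ∃ s : ℂ, ¬ (P₀ * P₁).IsRoot s := by
    by_contra hall
    push Not at hall
    apply hPP
    apply Polynomial.eq_zero_of_infinite_isRoot
    have : {s : ℂ | (P₀ * P₁).IsRoot s} = Set.univ := Set.eq_univ_of_forall fun s => hall s
    rw [this]; exact Set.infinite_univ
  obtain ⟨s, hs⟩ := hroot
  rw [Polynomial.IsRoot, Polynomial.eval_mul, mul_eq_zero, not_or] at hs
  refine ⟨s, fun hmem => hs.1 ?_, fun hmem => hs.2 ?_⟩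
  · rw [hP₀eval, ← hfc₀]; exact LinearMap.mem_ker.mp (hf₀W hmem)
  · rw [hP₁eval, ← hfc₁]; exact LinearMap.mem_ker.mp (hf₁W hmem)

/-! ## 2. Independence on a finset, for columns and rows of different types -/

/-- Linear independence of the vectors `col t`, `t ∈ A` (columns `ι`, rows `ρ`). -/
def IndepOn₂ {ι ρ : Type*} (col : ι → (ρ → ℂ)) (A : Finset ι) : Prop :=
  ∀ α : ι → ℂ, (∀ t, t ∉ A → α t = 0) → ∑ t ∈ A, α t • col t = 0 → ∀ t, α t = 0

/-- Independence only depends on the columns inside `A`. -/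
theorem indepOn₂_congr {ι ρ : Type*} (col col' : ι → (ρ → ℂ)) (A : Finset ι) (h : ∀ t ∈ A, col' t = col t)
    (hA : IndepOn₂ col A) : IndepOn₂ col' A := by
  intro α hα hsum
  refine hA α hα ?_
  rw [← hsum]
  exact Finset.sum_congr rfl fun t ht => by rw [h t ht]

/-- The empty family is independent. -/
theorem indepOn₂_empty {ι ρ : Type*} (col : ι → (ρ → ℂ)) : IndepOn₂ col ∅ :=
  fun _ hα _ t => hα t (Finset.notMem_empty t)

/-- **Inserting a column outside the span keeps independence.** -/
theorem indepOn₂_insert {ι ρ : Type*} [DecidableEq ι] (col : ι → (ρ → ℂ)) (A : Finset ι) (t₁ : ι) (ht₁ : t₁ ∉ A)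
    (hA : IndepOn₂ col A) (hout : col t₁ ∉ Submodule.span ℂ (Set.range fun t : A => col t)) :
    IndepOn₂ col (insert t₁ A) := by
  intro α hα hsum
  rw [Finset.sum_insert ht₁] at hsum
  have hα₁ : α t₁ = 0 := by
    by_contra hne
    apply hout
    have h1 : α t₁ • col t₁ = -∑ t ∈ A, α t • col t := eq_neg_of_add_eq_zero_left hsum
    have hexpr : col t₁ = -(α t₁)⁻¹ • ∑ t ∈ A, α t • col t := by
      calc col t₁ = (α t₁)⁻¹ • (α t₁ • col t₁) := by rw [smul_smul, inv_mul_cancel₀ hne, one_smul]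
        _ = -(α t₁)⁻¹ • ∑ t ∈ A, α t • col t := by rw [h1, smul_neg, neg_smul]
    rw [hexpr]
    refine Submodule.smul_mem _ _ (Submodule.sum_mem _ fun t ht => Submodule.smul_mem _ _ ?_)
    exact Submodule.subset_span ⟨⟨t, ht⟩, rfl⟩
  have hα' : ∀ t, t ∉ A → α t = 0 := by
    intro t ht
    by_cases htt : t = t₁
    · rw [htt]; exact hα₁
    · exact hα t (fun h' => by rcases Finset.mem_insert.mp h' with h'' | h''; exact htt h''; exact ht h'')
  rw [hα₁, zero_smul, zero_add] at hsum
  exact hA α hα' hsum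

/-- The span of fewer columns than the dimension is a proper subspace. -/
theorem span_lt_top_of_card_lt {ι ρ : Type*} [Fintype ρ] (col : ι → (ρ → ℂ)) (A : Finset ι)
    (hcard : A.card < Fintype.card ρ) : Submodule.span ℂ (Set.range fun t : A => col t) < ⊤ := by
  have h1 : Module.finrank ℂ (Submodule.span ℂ (Set.range fun t : A => col t)) ≤ Fintype.card A :=
    finrank_range_le_card _
  rw [Fintype.card_coe] at h1
  have h3 : Module.finrank ℂ (ρ → ℂ) = Fintype.card ρ := Module.finrank_fintype_fun_eq_card ℂ
  exact Submodule.lt_top_of_finrank_lt_finrank (by omega)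

/-! ## 3. Two-block curve filling: parameters good for two monomial families at once -/

open TwoLayer (exists_curveVec_not_mem) in
/-- **Two-block filling.** Given injective set families `u₀` (rows `n₀`) and `u₁` (rows `n₁`) and finsets `T₁ ⊆ T₀` of slots
with `|T₀| ≤ |n₀|`, `|T₁| ≤ |n₁|`, there are parameters `θ` such that the curve vectors `curveVec u₀ (θ t)`, `t ∈ T₀`, are
independent AND the curve vectors `curveVec u₁ (θ t)`, `t ∈ T₁`, are independent. -/
theorem exists_params₂ {ι n₀ n₁ : Type*} [DecidableEq ι] [Fintype n₀] [Fintype n₁] [DecidableEq n₀] [DecidableEq n₁]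
    (u₀ : n₀ → Finset (Fin h)) (hu₀ : Function.Injective u₀) (u₁ : n₁ → Finset (Fin h)) (hu₁ : Function.Injective u₁)
    (T₀ T₁ : Finset ι) (hT : T₁ ⊆ T₀) (h₀ : T₀.card ≤ Fintype.card n₀) (h₁ : T₁.card ≤ Fintype.card n₁) :
    ∃ θ : ι → ℂ, IndepOn₂ (fun t => curveVec u₀ (θ t)) T₀ ∧ IndepOn₂ (fun t => curveVec u₁ (θ t)) T₁ := by
  classical
  -- induction over D ⊆ T₀, keeping independence on D and on D ∩ T₁
  have H : ∀ D : Finset ι, D ⊆ T₀ →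
      ∃ θ : ι → ℂ, IndepOn₂ (fun t => curveVec u₀ (θ t)) D ∧ IndepOn₂ (fun t => curveVec u₁ (θ t)) (D ∩ T₁) := by
    intro D
    induction D using Finset.induction_on with
    | empty =>
      intro _
      refine ⟨fun _ => 0, indepOn₂_empty _, ?_⟩
      rw [Finset.empty_inter]; exact indepOn₂_empty _
    | @insert t₁ D ht₁ ih =>
      intro hsub
      obtain ⟨θ, hθ₀, hθ₁⟩ := ih ((Finset.subset_insert t₁ D).trans hsub)
      have ht₁T₀ : t₁ ∈ T₀ := hsub (Finset.mem_insert_self t₁ D)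
      have hDlt : D.card < T₀.card := Finset.card_lt_card (Finset.ssubset_iff_subset_ne.mpr
        ⟨(Finset.subset_insert t₁ D).trans hsub, fun heq => ht₁ (heq ▸ ht₁T₀)⟩)
      -- the current family-0 span is proper
      have hW₀ : Submodule.span ℂ (Set.range fun t : D => curveVec u₀ (θ t)) < ⊤ :=
        span_lt_top_of_card_lt (fun t => curveVec u₀ (θ t)) D (by omega)
      -- updating θ at t₁ does not change the families on D
      have hsame₀ : ∀ s, ∀ t ∈ D, curveVec u₀ (Function.update θ t₁ s t) = curveVec u₀ (θ t) := fun s t ht => by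
        have hne : t ≠ t₁ := by rintro rfl; exact ht₁ ht
        rw [Function.update_of_ne hne]
      have hsame₁ : ∀ s, ∀ t ∈ D ∩ T₁, curveVec u₁ (Function.update θ t₁ s t) = curveVec u₁ (θ t) := fun s t ht => by
        have hne : t ≠ t₁ := by rintro rfl; exact ht₁ (Finset.mem_of_mem_inter_left ht)
        rw [Function.update_of_ne hne]
      have hrange₀ : ∀ s, (Set.range fun t : D => curveVec u₀ (Function.update θ t₁ s t)) =
          Set.range fun t : D => curveVec u₀ (θ t) := fun s => by
        have : (fun t : D => curveVec u₀ (Function.update θ t₁ s t)) = fun t : D => curveVec u₀ (θ t) :=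
          funext fun t => hsame₀ s t t.2
        rw [this]
      have hrange₁ : ∀ s, (Set.range fun t : (D ∩ T₁ : Finset ι) => curveVec u₁ (Function.update θ t₁ s t)) =
          Set.range fun t : (D ∩ T₁ : Finset ι) => curveVec u₁ (θ t) := fun s => by
        have : (fun t : (D ∩ T₁ : Finset ι) => curveVec u₁ (Function.update θ t₁ s t)) =
            fun t : (D ∩ T₁ : Finset ι) => curveVec u₁ (θ t) := funext fun t => hsame₁ s t t.2
        rw [this]
      -- family 0 after the update, for a parameter s outside the span
      have hnew₀ : ∀ s, curveVec u₀ s ∉ Submodule.span ℂ (Set.range fun t : D => curveVec u₀ (θ t)) →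
          IndepOn₂ (fun t => curveVec u₀ (Function.update θ t₁ s t)) (insert t₁ D) := by
        intro s hs
        refine indepOn₂_insert _ D t₁ ht₁ (indepOn₂_congr _ _ D (hsame₀ s) hθ₀) ?_
        rw [hrange₀ s, Function.update_self]
        exact hs
      by_cases ht₁T₁ : t₁ ∈ T₁
      · -- both spans proper; avoid both
        have hD₁lt : (D ∩ T₁).card < T₁.card := Finset.card_lt_card (Finset.ssubset_iff_subset_ne.mpr
          ⟨Finset.inter_subset_right, fun heq => ht₁ (Finset.mem_of_mem_inter_left (heq.symm ▸ ht₁T₁))⟩)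
        have hW₁ : Submodule.span ℂ (Set.range fun t : (D ∩ T₁ : Finset ι) => curveVec u₁ (θ t)) < ⊤ :=
          span_lt_top_of_card_lt (fun t => curveVec u₁ (θ t)) (D ∩ T₁) (by omega)
        obtain ⟨s, hs₀, hs₁⟩ := exists_curve_avoid₂ u₀ hu₀ u₁ hu₁ _ hW₀ _ hW₁
        refine ⟨Function.update θ t₁ s, hnew₀ s hs₀, ?_⟩
        rw [Finset.insert_inter_of_mem ht₁T₁]
        have ht₁' : t₁ ∉ D ∩ T₁ := fun h' => ht₁ (Finset.mem_of_mem_inter_left h')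
        refine indepOn₂_insert _ (D ∩ T₁) t₁ ht₁' (indepOn₂_congr _ _ _ (hsame₁ s) hθ₁) ?_
        rw [hrange₁ s, Function.update_self]
        exact hs₁
      · obtain ⟨s, hs₀⟩ := exists_curveVec_not_mem u₀ hu₀ _ hW₀
        refine ⟨Function.update θ t₁ s, hnew₀ s hs₀, ?_⟩
        rw [Finset.insert_inter_of_notMem ht₁T₁]
        exact indepOn₂_congr _ _ _ (hsame₁ s) hθ₁
  obtain ⟨θ, hθ₀, hθ₁⟩ := H T₀ subset_rfl
  rw [Finset.inter_eq_right.mpr hT] at hθ₁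
  exact ⟨θ, hθ₀, hθ₁⟩

/-! ## 4. Balanced coordinates exist in every large injective family -/

/-- At most `h + 1` subsets of `Fin h` have at most one element. -/
theorem card_filter_card_le_one (𝒯 : Finset (Finset (Fin h))) : (𝒯.filter fun T => T.card ≤ 1).card ≤ h + 1 := by
  classical
  have hsub : (𝒯.filter fun T => T.card ≤ 1) ⊆ insert ∅ (Finset.univ.image fun a : Fin h => ({a} : Finset (Fin h))) := by
    intro T hT
    rw [Finset.mem_filter] at hT
    rcases Nat.lt_or_ge T.card 1 with h0 | h1
    · have : T = ∅ := Finset.card_eq_zero.mp (by omega)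
      rw [this]; exact Finset.mem_insert_self _ _
    · obtain ⟨a, ha⟩ := Finset.card_eq_one.mp (le_antisymm hT.2 h1)
      rw [ha]; exact Finset.mem_insert_of_mem (Finset.mem_image_of_mem _ (Finset.mem_univ a))
  refine (Finset.card_le_card hsub).trans ?_
  refine (Finset.card_insert_le _ _).trans ?_
  have : (Finset.univ.image fun a : Fin h => ({a} : Finset (Fin h))).card ≤ h :=
    Finset.card_image_le.trans (by simp)
  omega

/-- **Balanced coordinates.** If `u` is an injective family of `r` subsets of `Fin h` and `h·N + h + 2 < 2r` , some
coordinate `y` has at least `N` members avoiding it and at least `N` members containing it. (If not, let `C` be the set of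
coordinates whose avoiding side is small; then `Σ_i |C ∆ u i| ≤ h(N−1)`, while the sets `C ∆ u i` are distinct so all but
`h+1` of them have at least two elements.) -/
theorem exists_balanced_coord {r : ℕ} (u : Fin r → Finset (Fin h)) (hu : Function.Injective u) (N : ℕ)
    (hr : h * N + h + 2 < 2 * r) :
    ∃ y : Fin h, N ≤ (Finset.univ.filter fun i => y ∉ u i).card ∧ N ≤ (Finset.univ.filter fun i => y ∈ u i).card := by
  classical
  by_contra H
  push Not at H
  -- C = coordinates whose avoiding side is small
  set C : Finset (Fin h) := Finset.univ.filter fun y => (Finset.univ.filter fun i => y ∉ u i).card < N with hC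
  let cost : Fin h → ℕ := fun y =>
    if y ∈ C then (Finset.univ.filter fun i => y ∉ u i).card else (Finset.univ.filter fun i => y ∈ u i).card
  have hcost : ∀ y, cost y + 1 ≤ N := by
    intro y
    by_cases hy : y ∈ C
    · have : (Finset.univ.filter fun i => y ∉ u i).card < N := by simpa [hC] using hy
      simp only [cost, if_pos hy]; omega
    · have h1 : ¬ (Finset.univ.filter fun i => y ∉ u i).card < N := by simpa [hC] using hy
      have h2 := H y (not_lt.mp h1)
      simp only [cost, if_neg hy]; omega
  -- upper bound on the total cost
  have hupper : ∑ y, cost y + h ≤ h * N := by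
    have := Finset.sum_le_sum fun y (_ : y ∈ (Finset.univ : Finset (Fin h))) => hcost y
    simp only [Finset.sum_add_distrib, Finset.sum_const, Finset.card_univ, Fintype.card_fin, smul_eq_mul, mul_one] at this
    linarith
  -- double counting: total cost = Σ_i |C ∆ u i|
  have hdouble : ∑ y, cost y = ∑ i, (symmDiff C (u i)).card := by
    have hc : ∀ y, cost y = ∑ i, (if y ∈ symmDiff C (u i) then 1 else 0) := by
      intro y
      have key : ∀ i, (y ∈ symmDiff C (u i)) ↔ (if y ∈ C then y ∉ u i else y ∈ u i) := by
        intro i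
        rw [Finset.mem_symmDiff]
        by_cases hy : y ∈ C <;> simp [hy]
      simp only [cost]
      by_cases hy : y ∈ C
      · rw [if_pos hy, Finset.card_filter]
        refine Finset.sum_congr rfl fun i _ => ?_
        simp [key i, hy]
      · rw [if_neg hy, Finset.card_filter]
        refine Finset.sum_congr rfl fun i _ => ?_
        simp [key i, hy]
    simp_rw [hc]
    rw [Finset.sum_comm]
    refine Finset.sum_congr rfl fun i _ => ?_
    rw [Finset.card_eq_sum_ones, Finset.sum_boole]
    simp
  -- lower bound: the sets C ∆ u i are distinct; at most h+1 of them are small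
  set G : Finset (Fin r) := Finset.univ.filter fun i => (symmDiff C (u i)).card ≤ 1 with hG
  have hGcard : G.card ≤ h + 1 := by
    have hinj : Set.InjOn (fun i => symmDiff C (u i)) G := by
      intro i _ j _ hij
      apply hu
      have := congrArg (symmDiff C) hij
      simpa [symmDiff_symmDiff_cancel_left] using this
    have hmaps : ∀ i ∈ G, symmDiff C (u i) ∈ (Finset.univ : Finset (Finset (Fin h))).filter fun T => T.card ≤ 1 := by
      intro i hi
      simp only [hG, Finset.mem_filter, Finset.mem_univ, true_and] at hi
      simpa using hi
    exact (Finset.card_le_card_of_injOn _ hmaps hinj).trans (card_filter_card_le_one _)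
  have hlower : 2 * r ≤ ∑ i, (symmDiff C (u i)).card + 2 * (h + 1) := by
    have h2 : ∀ i : Fin r, 2 ≤ (symmDiff C (u i)).card + 2 * (if i ∈ G then 1 else 0) := by
      intro i
      by_cases hi : i ∈ G
      · simp [hi]
      · have : ¬ (symmDiff C (u i)).card ≤ 1 := by simpa [hG] using hi
        simp [hi]; omega
    have hsum := Finset.sum_le_sum fun i (_ : i ∈ (Finset.univ : Finset (Fin r))) => h2 i
    simp only [Finset.sum_const, Finset.card_univ, Fintype.card_fin, smul_eq_mul, Finset.sum_add_distrib,
      ← Finset.mul_sum, Finset.sum_boole] at hsum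
    have hGc : ((Finset.univ.filter fun i => i ∈ G).card : ℕ) = G.card := by
      congr 1; ext i; simp
    rw [hGc] at hsum
    nlinarith
  rw [← hdouble] at hlower
  omega

end HubAxis

end

end Summit.ValiantsHypothesis.ValiantsHypothesis.Theorems.BarrierLever.HiddenStates
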